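/-
Width seat `ym-line-cbag-p1-w3` (prover-ym-line-cbag-p1-w3-g8-0; own items stmt-QuantumFields-22254 `BoxFloorAllGroups` /
stmt-QuantumFields-22893 `ExpChartPackage2` CLOSED proved), helping LINE 3 `route-QuantumFields-SixPlaneColdBox`
(crux stmt-QuantumFields-25709 `DensityTransferG`, skeleton stub `stub_sixPlaneTransferWithSlackG`): the flat-datum covariance of ANY two
near-centre plaquette costs to precision `β^{−1/5}`, and the DATUM-MINUS-FLAT comparisons of kernel covariances and means (the explicit datum
terms `2β·(Σ_c F̄_c(q)F̄_c(q'))·C_D(q,q')` and `β·Σ_c F̄_c(q)²` isolated), every compact simple `G`.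
-/
import Summits.QuantumFields.YangMills.Theorems.SixPlaneColdBoxKernelCovPairsSharpG
import Summits.QuantumFields.YangMills.Theorems.SixPlaneColdBoxFlatBoxMeanG

/-!
# LINE 3 `SixPlaneColdBox`, glue «KernelCovPairsG», part 3: flat-datum covariances of all near-centre pairs and the datum-minus-flat comparisons

The DLR transfer of crux `DensityTransferG` compares, pair by pair (`q = (c_H; i<j)`, `q' = (c_H + Te₀; k<l)`, 36 plane pairs) and under a
crude-good datum `ω`, the box-kernel covariance `Cov_ω(c_q, c_{q'})` with the cold-wall one `Cov_1(c_q, c_{q'})`, and the kernel mean `E_ω c_q`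
with `E_1 c_q`.  By the sharp one-scale expansions (parts 2/2b) both kernels have the SAME Gaussian main terms `(D/2)·C_D(q,q')²`, `(D/2)·V_D(q)`;
what remains is the datum: `β²(Cov_ω − Cov_1) = 2β·(Σ_c F̄_c(q)F̄_c(q'))·C_D(q,q') ± 2β^{−1/5}` and `β(E_ω − E_1) = β·Σ_c F̄_c(q)² ± 2β^{−1/4}`,
`F̄_c` the Dirichlet background of the chart datum of `ω` — the indefinite quadratic form and the positive energy the planner's transfer bounds
inside the DLR average («`E_torus|F̄|² ≤ 2·(mean difference) + o(β^{−1−4A})`»).  This file records exactly these inputs: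

* `abs_sub_sub_le_of_expansions` — real bookkeeping;
* **`flatBoxCov_sharp_pairs`** — flat datum, trivial chart package `(g, ϑ, s) = (1, 0, 0)` in `kernelCovSharpPairsG_of_package`: for a faithful
  continuous unitary `ρ : G →* U(N)` and `0 < θ ≤ 1/200`, eventually in `β`, for all base points `x, y` within `H/8` of the centre and all planes,
  `|β²·Cov_{boxState ρ β H}(c_{(x;i,j)}, c_{(y;k,l)}) − (D/2)·C_D((x;i,j),(y;k,l))²| ≤ β^{−1/5}` (`H = ⌈β^θ⌉`, `D = dimE ρ`);
* **`datumMinusFlat_sharp`** — every compact simple `G`, every `r : LatticeRep G`, `0 < θ ≤ 1/200`: there are `CE, β₀` such that for `β ≥ β₀`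
  and every crude-good `ω` (scale `β^{2(θ/5)−1}`) there are one-colour Dirichlet data `ϑ c` and competitors `s c` of total Maxwell energy
  `≤ CE(2H+3)⁴β^{2(θ/5)−1}` with, for all near-centre `x, y` and planes `i<j`, `k<l`,
  `|β²·Cov_ω(c_{(x;i,j)},c_{(y;k,l)}) − β²·Cov_1(c_{(x;i,j)},c_{(y;k,l)}) − 2β·(Σ_c F̄_c(x;i,j)F̄_c(y;k,l))·C_D| ≤ 2β^{−1/5}` and
  `|β·E_ω[c_{(x;i,j)}] − β·E_1[c_{(x;i,j)}] − β·Σ_c F̄_c(x;i,j)²| ≤ 2β^{−1/4}`.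

No sorry; no new definition; standard axioms.  NOT a claim about the Yang–Mills mass gap: glue for a LINE onto the RECORD-type node
`LatticeNonFreezing`; the line's cruxes and every summit statement remain open/untouched.
-/

set_option autoImplicit false

noncomputable section

open MeasureTheory ProbabilityTheory Finset Real Filter Topology Metric
open scoped ENNReal
open Literature.Probability.LatticeModels (Site glueWith)
open Literature.MathematicalPhysics.QuantumLattice
open Literature.MathematicalPhysics.QuantumFieldTheory
open Literature.MathematicalPhysics.QuantumFieldTheory.LatticeMaxwell
open Literature.MathematicalPhysics.QuantumFieldTheory.AxialGauge
open Summit.QuantumFields.YangMills.Theorems.WeakCouplingRates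
open Summit.QuantumFields.YangMills.Theorems.FreeEnergyLogCoefficient

namespace Summit.QuantumFields.YangMills.Theorems.ColdBoxAllGroups

/-- Real bookkeeping: two quantities with the same Gaussian main term `g` differ by the datum term `d` up to the two errors. -/
theorem abs_sub_sub_le_of_expansions {a b g d ε₁ ε₂ : ℝ} (h₁ : |a - g - d| ≤ ε₁) (h₂ : |b - g| ≤ ε₂) :
    |a - b - d| ≤ ε₁ + ε₂ := by
  rw [abs_le] at h₁ h₂ ⊢
  constructor <;> linarith [h₁.1, h₁.2, h₂.1, h₂.2]

section Box

variable {N : ℕ} [NeZero N] {G : Type} [Group G] [TopologicalSpace G] [IsTopologicalGroup G] [CompactSpace G]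
  [MeasurableSpace G] [BorelSpace G]
variable (ρ : G →* Matrix (Fin N) (Fin N) ℂ)

/-- **The cold-wall covariance of ANY two near-centre plaquette costs is its Dirichlet–Gaussian value `(D/2)·C_D²` up to `β^{−1/5}` (in
`β²`-units).**  For a faithful continuous unitary `ρ : G →* U(N)` (`N ≥ 1`) and `0 < θ ≤ 1/200`: eventually in `β`, for all base points `x, y`
within `H/8` of the centre of the cold box `H = ⌈β^θ⌉` and all planes `i<j`, `k<l`,
`|β²·(∫ c_{(x;i,j)}c_{(y;k,l)} − ∫ c_{(x;i,j)} ∫ c_{(y;k,l)})_{boxState ρ β H} − (D/2)·boxDirProjKernel H (x;i,j) (y;k,l)²| ≤ β^{−1/5}`. -/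
theorem flatBoxCov_sharp_pairs (hρc : Continuous ρ) (hinj : Function.Injective ρ)
    (hρu : ∀ g, ρ g ∈ Matrix.unitaryGroup (Fin N) ℂ) {θ : ℝ} (hθ : 0 < θ) (hθ2 : θ ≤ 1 / 200) :
    ∃ β₀ : ℝ, ∀ β : ℝ, β₀ ≤ β →
      ∀ x y : Site 4, (∀ n : Fin 4, 8 * |x n - (⌈β ^ θ⌉₊ : ℤ)| ≤ (⌈β ^ θ⌉₊ : ℤ)) → (∀ n : Fin 4, 8 * |y n - (⌈β ^ θ⌉₊ : ℤ)| ≤ (⌈β ^ θ⌉₊ : ℤ)) →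
        ∀ (i j k l : Fin 4), i < j → k < l →
        |β ^ 2 * ((∫ U, plaqCostAt ρ x i j U * plaqCostAt ρ y k l U ∂(boxState ρ β ⌈β ^ θ⌉₊)) -
              (∫ U, plaqCostAt ρ x i j U ∂(boxState ρ β ⌈β ^ θ⌉₊)) * (∫ U, plaqCostAt ρ y k l U ∂(boxState ρ β ⌈β ^ θ⌉₊))) -
            (dimE ρ : ℝ) / 2 * boxDirProjKernel ⌈β ^ θ⌉₊ (x, i, j) (y, k, l) ^ 2| ≤ β ^ (-(1 / 5 : ℝ)) := by
  obtain ⟨β₀, h⟩ := kernelCovSharpPairsG_of_package ρ hρc hinj hρu hθ hθ2 (Ca := 1) one_pos 1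
  refine ⟨max β₀ 0, fun β hβ x y hx hy i j k l hij hkl => ?_⟩
  have hb₀ : β₀ ≤ β := (le_max_left _ _).trans hβ
  have hβ0 : 0 ≤ β := (le_max_right _ _).trans hβ
  -- the trivial package of the flat datum
  have hω : CrudeGoodG ρ β (θ / 5) ⌈β ^ θ⌉₊ (fun _ => 1) := crudeGoodG_one ρ hβ0 _
  have hW : ∀ e, forestFix ⌈β ^ θ⌉₊ (glueWith (boxEdgesAt dirCorner (2 * ⌈β ^ θ⌉₊ + 3))
      (fun e' : ↥(boxEdgesAt dirCorner (2 * ⌈β ^ θ⌉₊ + 3)) => gaugeTransformZd (fun _ : Site 4 => (1 : G))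
        (fun _ : Literature.MathematicalPhysics.QuantumLattice.ZdEdge 4 => (1 : G)) e'.1) (fun _ => 1)) e =
      expChart ρ (datVec (0 : Fin (dimE ρ) → Literature.MathematicalPhysics.QuantumLattice.ZdEdge 4 → ℝ) e) := fun e => by
    rw [glueWith_gaugeTransformZd_one_one, forestFix_one, datVec_zero, Pi.zero_apply, expChart_zero ρ hρc hinj]
  have hϑr : ∀ e, ‖datVec (0 : Fin (dimE ρ) → Literature.MathematicalPhysics.QuantumLattice.ZdEdge 4 → ℝ) e‖ ≤
      1 * β ^ (3 * θ + θ / 5 - 1 / 2) := fun e => by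
    rw [datVec_zero, Pi.zero_apply, norm_zero]; positivity
  have hforest : ∀ z : Site 4, (∀ n : Fin 4, 1 ≤ z n ∧ z n + 1 ≤ 2 * (⌈β ^ θ⌉₊ : ℤ)) →
      ∀ c, (0 : Fin (dimE ρ) → Literature.MathematicalPhysics.QuantumLattice.ZdEdge 4 → ℝ) c (z, 0) = 0 := fun _ _ _ => rfl
  have hE : ∑ c, formM (fun e => e ∉ dirFreeEdges ⌈β ^ θ⌉₊) dirCorner (2 * ⌈β ^ θ⌉₊ + 3)
      ((0 : Fin (dimE ρ) → Literature.MathematicalPhysics.QuantumLattice.ZdEdge 4 → ℝ) c) ((0 : Fin (dimE ρ) → DirFree ⌈β ^ θ⌉₊ → ℝ) c) ≤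
      1 * (2 * (⌈β ^ θ⌉₊ : ℝ) + 3) ^ 4 * β ^ (2 * (θ / 5) - 1) := by
    have h0 : ∑ c, formM (fun e => e ∉ dirFreeEdges ⌈β ^ θ⌉₊) dirCorner (2 * ⌈β ^ θ⌉₊ + 3)
        ((0 : Fin (dimE ρ) → Literature.MathematicalPhysics.QuantumLattice.ZdEdge 4 → ℝ) c) ((0 : Fin (dimE ρ) → DirFree ⌈β ^ θ⌉₊ → ℝ) c) = 0 :=
      Finset.sum_eq_zero fun c _ => by simp only [Pi.zero_apply]; exact formM_zero_zero _
    rw [h0]; positivity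
  have key := h β hb₀ (fun _ => 1) (fun _ => 1) 0 0 hω hW hϑr hforest hE x y hx hy i j k l hij hkl
  -- the cross term of the zero datum vanishes
  have hF : ∑ c, sCirc (glue (pin := fun e => e ∉ dirFreeEdges ⌈β ^ θ⌉₊) dirCorner (2 * ⌈β ^ θ⌉₊ + 3)
        ((1 / Real.sqrt 2) • (0 : Fin (dimE ρ) → Literature.MathematicalPhysics.QuantumLattice.ZdEdge 4 → ℝ) c)
        (mean (fun e => e ∉ dirFreeEdges ⌈β ^ θ⌉₊) dirCorner (2 * ⌈β ^ θ⌉₊ + 3)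
          ((1 / Real.sqrt 2) • (0 : Fin (dimE ρ) → Literature.MathematicalPhysics.QuantumLattice.ZdEdge 4 → ℝ) c))) (x, i, j) *
      sCirc (glue (pin := fun e => e ∉ dirFreeEdges ⌈β ^ θ⌉₊) dirCorner (2 * ⌈β ^ θ⌉₊ + 3)
        ((1 / Real.sqrt 2) • (0 : Fin (dimE ρ) → Literature.MathematicalPhysics.QuantumLattice.ZdEdge 4 → ℝ) c)
        (mean (fun e => e ∉ dirFreeEdges ⌈β ^ θ⌉₊) dirCorner (2 * ⌈β ^ θ⌉₊ + 3)
          ((1 / Real.sqrt 2) • (0 : Fin (dimE ρ) → Literature.MathematicalPhysics.QuantumLattice.ZdEdge 4 → ℝ) c))) (y, k, l) = 0 :=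
    Finset.sum_eq_zero fun c _ => by
      rw [Pi.zero_apply, smul_zero, sCirc_glue_zero_mean_zero, sCirc_glue_zero_mean_zero]; simp
  rw [hF, mul_zero, zero_mul, sub_zero, boxKernelG_one] at key
  exact key

end Box

/-- **Datum minus flat, covariances of all near-centre pairs and means of all near-centre plaquettes, every compact simple `G`.**  For
`0 < θ ≤ 1/200` there are `CE, β₀` such that for `β ≥ β₀` and every crude-good datum `ω` (scale `β^{2(θ/5)−1}`, box `H = ⌈β^θ⌉`) there are
one-colour Dirichlet data `ϑ c` and competitors `s c` of total Maxwell energy `≤ CE(2H+3)⁴β^{2(θ/5)−1}` such that, for all base points `x, y` within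
`H/8` of the centre and all planes `i<j`, `k<l`:
`|β²·Cov_ω(c_{(x;i,j)}, c_{(y;k,l)}) − β²·Cov_1(c_{(x;i,j)}, c_{(y;k,l)}) − 2β·(Σ_c F̄_c(x;i,j)F̄_c(y;k,l))·C_D((x;i,j),(y;k,l))| ≤ 2β^{−1/5}` and
`|β·E_ω[c_{(x;i,j)}] − β·E_1[c_{(x;i,j)}] − β·Σ_c F̄_c(x;i,j)²| ≤ 2β^{−1/4}`
(`ω`-kernel `boxKernelG r.ρ β H ω`, flat kernel `boxState r.ρ β H`, `F̄_c = sCirc (glue (ϑ c) (mean (ϑ c)))`). -/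
theorem datumMinusFlat_sharp
    (G : Type) [Group G] [TopologicalSpace G] [IsTopologicalGroup G] [CompactSpace G] [MeasurableSpace G] [BorelSpace G]
    (hG : IsCompactSimpleLieGroup G) (r : LatticeRep G) {θ : ℝ} (hθ : 0 < θ) (hθ2 : θ ≤ 1 / 200) :
    ∃ CE : ℝ, ∃ β₀ : ℝ, ∀ β : ℝ, β₀ ≤ β → ∀ ω : LGConfig 4 G, CrudeGoodG r.ρ β (θ / 5) ⌈β ^ θ⌉₊ ω →
      ∃ ϑ : Fin (dimE r.ρ) → (Literature.MathematicalPhysics.QuantumLattice.ZdEdge 4 → ℝ), ∃ s : Fin (dimE r.ρ) → (DirFree ⌈β ^ θ⌉₊ → ℝ),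
        (∑ c, formM (fun e => e ∉ dirFreeEdges ⌈β ^ θ⌉₊) dirCorner (2 * ⌈β ^ θ⌉₊ + 3) (ϑ c) (s c) ≤
            CE * (2 * (⌈β ^ θ⌉₊ : ℝ) + 3) ^ 4 * β ^ (2 * (θ / 5) - 1)) ∧
        (∀ x y : Site 4, (∀ n : Fin 4, 8 * |x n - (⌈β ^ θ⌉₊ : ℤ)| ≤ (⌈β ^ θ⌉₊ : ℤ)) →
          (∀ n : Fin 4, 8 * |y n - (⌈β ^ θ⌉₊ : ℤ)| ≤ (⌈β ^ θ⌉₊ : ℤ)) → ∀ (i j k l : Fin 4), i < j → k < l →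
          |β ^ 2 * ((∫ U, plaqCostAt r.ρ x i j U * plaqCostAt r.ρ y k l U ∂(boxKernelG r.ρ β ⌈β ^ θ⌉₊ ω)) -
                (∫ U, plaqCostAt r.ρ x i j U ∂(boxKernelG r.ρ β ⌈β ^ θ⌉₊ ω)) *
                  (∫ U, plaqCostAt r.ρ y k l U ∂(boxKernelG r.ρ β ⌈β ^ θ⌉₊ ω))) -
              β ^ 2 * ((∫ U, plaqCostAt r.ρ x i j U * plaqCostAt r.ρ y k l U ∂(boxState r.ρ β ⌈β ^ θ⌉₊)) -
                (∫ U, plaqCostAt r.ρ x i j U ∂(boxState r.ρ β ⌈β ^ θ⌉₊)) *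
                  (∫ U, plaqCostAt r.ρ y k l U ∂(boxState r.ρ β ⌈β ^ θ⌉₊))) -
              2 * β * (∑ c,
                  sCirc (glue (pin := fun e => e ∉ dirFreeEdges ⌈β ^ θ⌉₊) dirCorner (2 * ⌈β ^ θ⌉₊ + 3) (ϑ c)
                      (mean (fun e => e ∉ dirFreeEdges ⌈β ^ θ⌉₊) dirCorner (2 * ⌈β ^ θ⌉₊ + 3) (ϑ c))) (x, i, j) *
                    sCirc (glue (pin := fun e => e ∉ dirFreeEdges ⌈β ^ θ⌉₊) dirCorner (2 * ⌈β ^ θ⌉₊ + 3) (ϑ c)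
                      (mean (fun e => e ∉ dirFreeEdges ⌈β ^ θ⌉₊) dirCorner (2 * ⌈β ^ θ⌉₊ + 3) (ϑ c))) (y, k, l)) *
                boxDirProjKernel ⌈β ^ θ⌉₊ (x, i, j) (y, k, l)| ≤
            2 * β ^ (-(1 / 5 : ℝ))) ∧
        (∀ x : Site 4, (∀ n : Fin 4, 8 * |x n - (⌈β ^ θ⌉₊ : ℤ)| ≤ (⌈β ^ θ⌉₊ : ℤ)) → ∀ (i j : Fin 4), i < j →
          |β * (∫ U, plaqCostAt r.ρ x i j U ∂(boxKernelG r.ρ β ⌈β ^ θ⌉₊ ω)) -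
              β * (∫ U, plaqCostAt r.ρ x i j U ∂(boxState r.ρ β ⌈β ^ θ⌉₊)) -
              β * ∑ c, sCirc (glue (pin := fun e => e ∉ dirFreeEdges ⌈β ^ θ⌉₊) dirCorner (2 * ⌈β ^ θ⌉₊ + 3)
                (ϑ c) (mean (fun e => e ∉ dirFreeEdges ⌈β ^ θ⌉₊) dirCorner (2 * ⌈β ^ θ⌉₊ + 3) (ϑ c))) (x, i, j) ^ 2| ≤
            2 * β ^ (-(1 / 4 : ℝ))) := by
  haveI : NeZero r.N := ⟨latticeRep_N_ne_zero G hG r⟩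
  have hδ0 : (0 : ℝ) ≤ θ / 5 := by positivity
  have hwin9 : 9 * θ + θ / 5 < 1 / 2 := by linarith
  obtain ⟨Ca, CE, hCa, -, β₁, hpack⟩ :=
    exists_datum_packageG_datVec r.ρ r.continuous r.injective r.mem_unitary (θ := θ) (δ := θ / 5) hθ hδ0 hwin9
  obtain ⟨β₂, hcov⟩ := kernelCovSharpPairsG_of_package r.ρ r.continuous r.injective r.mem_unitary hθ hθ2 hCa CE
  obtain ⟨β₃, hmean⟩ := kernelMeanSharpG_of_package r.ρ r.continuous r.injective r.mem_unitary hθ hθ2 hCa CE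
  obtain ⟨β₄, hcov1⟩ := flatBoxCov_sharp_pairs r.ρ r.continuous r.injective r.mem_unitary hθ hθ2
  obtain ⟨β₅, hmean1⟩ := flatBoxMean_sharp r.ρ r.continuous r.injective r.mem_unitary hθ hθ2
  refine ⟨CE, max (max β₁ (max β₂ β₃)) (max β₄ β₅), fun β hβ ω hω => ?_⟩
  have hb₁ : β₁ ≤ β := ((le_max_left _ _).trans (le_max_left _ _)).trans hβ
  have hb₂ : β₂ ≤ β := (((le_max_left _ _).trans (le_max_right _ _)).trans (le_max_left _ _)).trans hβ
  have hb₃ : β₃ ≤ β := (((le_max_right _ _).trans (le_max_right _ _)).trans (le_max_left _ _)).trans hβ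
  have hb₄ : β₄ ≤ β := ((le_max_left _ _).trans (le_max_right _ _)).trans hβ
  have hb₅ : β₅ ≤ β := ((le_max_right _ _).trans (le_max_right _ _)).trans hβ
  obtain ⟨g, ϑ, s, hW, hϑr, -, -, hforest, -, hE⟩ := hpack β hb₁ ω hω
  refine ⟨fun c => (Real.sqrt 2)⁻¹ • ϑ c, fun c => (Real.sqrt 2)⁻¹ • s c, sum_formM_interface_le ϑ s hE,
    fun x y hx hy i j k l hij hkl => ?_, fun x hx i j hij => ?_⟩
  · have h₁ := hcov β hb₂ ω g ϑ s hω hW hϑr hforest hE x y hx hy i j k l hij hkl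
    have h₂ := hcov1 β hb₄ x y hx hy i j k l hij hkl
    have h := abs_sub_sub_le_of_expansions h₁ h₂
    simp only [one_div] at h
    refine le_of_le_of_eq h (by ring)
  · have h₁ := hmean β hb₃ ω g ϑ s hω hW hϑr hforest hE x hx i j hij
    have h₂ := hmean1 β hb₅ x hx i j hij
    have h := abs_sub_sub_le_of_expansions h₁ h₂
    simp only [one_div] at h
    refine le_of_le_of_eq h (by ring)

end Summit.QuantumFields.YangMills.Theorems.ColdBoxAllGroups

end
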